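import Mathlib
import Summits.ResolutionOfSingularities.ResolutionOfSingularities.Theses.PAlteration
import Summits.ResolutionOfSingularities.ResolutionOfSingularities.Theorems.PAlterationPicoverLocalModelGiraudReduction
import Summits.ResolutionOfSingularities.ResolutionOfSingularities.Theorems.PAlterationPicoverLocalModelLocalCharts
import Summits.ResolutionOfSingularities.ResolutionOfSingularities.Theorems.PAlterationPicoverLocalModelBadLocusFinite
import Summits.ResolutionOfSingularities.ResolutionOfSingularities.Theorems.PAlterationPicoverLocalModelBoundaryPointNormalForm
import Summits.ResolutionOfSingularities.ResolutionOfSingularities.Theorems.PAlterationPicoverLocalModelSpecCurveNormalForm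
import Literature.AlgebraicGeometry.Resolution.LogRegularAtlasGluing
import Literature.AlgebraicGeometry.Resolution.SurfaceResolutionReduction

/-!
# Crux `PicoverLocalModel` (stmt-ResolutionOfSingularities-0557), line `SketchIdeator3`
# (giraud-cossart-normal-form) — the graded reduction: crux ⇐ (Giraud–Cossart normal form in
# dimension `n ≥ 2`) ∧ (Kato 1994 (10.4))

This file records, as sorry-free theorems, exactly how far the line `SketchIdeator3` has brought
the crux `PicoverLocalModel` (resolution of the purely inseparable cover `t^p = a` of a regular
affine `k`-variety `Spec R`, `char k = p`):

* `cossartNormalForm_le_one` — **the residue in dimension `≤ 1` is PROVED**: for `R` a regular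
  finitely generated `k`-domain of dimension `≤ 1` and `a ∈ R ∖ R^p`, the identity of `Spec R`
  with the finitely many bad closed points as boundary is a Giraud normal form datum
  (`InGiraudNormalForm`, snc boundary) — composed from the landed stubs
  `BadLocusFinite.stub_badLocusFinite` (p150029), `BoundaryPointNormalForm.stub_boundaryPointNormalForm`
  (p151218) and `SpecCurveNormalForm.stub_specCurveNormalForm` (p151768);
* `endgameAtlas` — **the endgame's algebraic half**: the normalisation of the pulled-back model
  of a radicand in Giraud normal form along an snc boundary of a regular integral separated
  finite-type `k`-scheme is proper and birational over it and carries a log-regular Zariski fs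
  atlas (`LogRegularAtlas`; local charts `LocalCharts.stub_localCharts`, p145190, glued by
  `logRegularAtlas_of_localLogRegularChart`);
* `picoverLocalModel_of_kato_of_normalForm_ge_two` — **the graded reduction**: if Kato's theorem
  `Kato1994_logRegular_hasResolution_general` (Kato 1994 (10.4); Nizioł 2006 Thm. 5.8 — a
  printed theorem, unproved in tree) holds and the Giraud–Cossart normal form exists for regular
  finitely generated `k`-domains of every dimension `n ≥ 2` (Giraud 1983 for `n = 2` over perfect
  fields, Cossart 1987 for `n = 3` over algebraically closed fields, OPEN for `n ≥ 4` and over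
  imperfect fields), then `PicoverLocalModel` holds.

Compared with `GiraudReduction.picoverLocalModel_of_normalForm_of_atlas` (p135141: RESIDUE ∀ n +
ATLAS + Kato ⇒ crux) the ATLAS hypothesis is discharged and the RESIDUE hypothesis is restricted
to `n ≥ 2`. The two remaining hypotheses are the registered open stubs
`stub_cossartNormalForm_ge_two` and `stub_logResolution` of the line's skeleton (v7).
-/

noncomputable section

-- single-problem summit: the doubled namespace component `ResolutionOfSingularities` is the tree layout
set_option linter.dupNamespace false

open CategoryTheory CategoryTheory.Limits AlgebraicGeometry TopologicalSpace Polynomial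
open Literature.AlgebraicGeometry.Resolution

namespace Summit.ResolutionOfSingularities.ResolutionOfSingularities.Theorems.PicoverLocalModel.GiraudReductionGraded

/-- **Giraud–Cossart normal form in dimension `≤ 1`** (regular affine curves and points over any
field of characteristic `p`): for `R` a regular finitely generated `k`-domain of dimension `≤ 1`
and `a ∈ R ∖ R^p` there are a proper birational `π : W → Spec R` with `W` regular integral and an
snc boundary `E` with `π^* a` in Giraud normal form along `E` — namely `W = Spec R`, `π = 𝟙`,
`E =` the finitely many closed points where `a` is neither wound nor transversal modulo `p`-th
powers (`BadLocusFinite.stub_badLocusFinite`), at which the DVR dichotomy puts `a` in normal form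
(`BoundaryPointNormalForm.stub_boundaryPointNormalForm`), packaged on the scheme `Spec R`
(`SpecCurveNormalForm.stub_specCurveNormalForm`). [folklore] -/
theorem cossartNormalForm_le_one : ∀ (p : ℕ), p.Prime → ∀ (k : Type) [Field k] [CharP k p]
    (R : Type) [CommRing R] [IsDomain R] [Algebra k R], Algebra.FiniteType k R → IsRegularRing R →
    ringKrullDim R ≤ 1 → ∀ a : R, (∀ b : R, b ^ p ≠ a) →
      ∃ (W : Scheme.{0}) (π : W ⟶ Spec (.of R)) (E : List W.IdealSheafData),
        IsProper π ∧ IsBirational π ∧ IsIntegral W ∧ Scheme.IsRegular W ∧ HasSNC E ∧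
          InGiraudNormalForm p W π a E := by
  intro p hp k _ _ R _ _ _ hft hreg hdim a ha
  obtain ⟨hfin, hne⟩ := BadLocusFinite.stub_badLocusFinite p hp k R hft hreg hdim a ha
  refine SpecCurveNormalForm.stub_specCurveNormalForm p R hreg hdim a _ hfin
    (fun q hq => hne q hq) ?_ ?_
  · intro q hq
    by_contra h
    exact hq h
  · intro q hq ϖ hϖ
    exact BoundaryPointNormalForm.stub_boundaryPointNormalForm p hp k R hft hreg hdim a ha q
      (hne q hq) ϖ hϖ

/-- **The endgame atlas**: for a radicand `a` in Giraud normal form along an snc boundary `E` of a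
regular integral separated finite-type `k`-scheme `W → Spec R` with integral pulled-back model
`Y = X_a ×_{Spec R} W`, the normalisation `ν : Y^ν → Y` is finite (E. Noether) hence proper, it
is birational, and `Y^ν` carries a log-regular Zariski fs atlas, glued
(`logRegularAtlas_of_localLogRegularChart`) from the local charts of
`LocalCharts.stub_localCharts` (regular with snc boundary over the wound/transversal points, Kummer
toric over the Kummer points; Giraud 1983 Prop. 1.5, Kato 1994 Thm. 11.6).
[cite: Giraud1983, Prop. 1.5] -/
theorem endgameAtlas (p : ℕ) [Fact p.Prime] (k : Type) [Field k] [CharP k p]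
    (W : Scheme.{0}) (f : W ⟶ Spec (.of k)) [IsSeparated f] [LocallyOfFiniteType f]
    [QuasiCompact f] [IsIntegral W] (hW : Scheme.IsRegular W)
    (R : Type) [CommRing R] (π : W ⟶ Spec (.of R)) (a : R) (E : List W.IdealSheafData)
    (hE : HasSNC E) (hNF : InGiraudNormalForm p W π a E)
    (hint : IsIntegral (pullback
        (Spec.map (CommRingCat.ofHom (algebraMap R (AdjoinRoot ((X : R[X]) ^ p - C a))))) π)) :
    ∃ (Y' : Scheme.{0}) (ν : Y' ⟶ pullback
        (Spec.map (CommRingCat.ofHom (algebraMap R (AdjoinRoot ((X : R[X]) ^ p - C a))))) π),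
      IsProper ν ∧ IsBirational ν ∧ Nonempty (LogRegularAtlas Y') := by
  haveI := hint
  set Y := pullback (Spec.map (CommRingCat.ofHom
    (algebraMap R (AdjoinRoot ((X : R[X]) ^ p - C a))))) π with hY
  haveI := PullbackIntegral.isFinite_model p R a
  haveI : CompactSpace ↥W := QuasiCompact.compactSpace_of_compactSpace f
  let g : Y ⟶ Spec (.of k) := pullback.snd _ _ ≫ f
  haveI : LocallyOfFiniteType g := inferInstance
  haveI := isFinite_normalizationι Y NoetherFiniteIntegralClosure_holds g
  haveI : CompactSpace ↥Y := QuasiCompact.compactSpace_of_compactSpace (pullback.snd _ _ : Y ⟶ W)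
  haveI : CompactSpace ↥(normalization Y) :=
    QuasiCompact.compactSpace_of_compactSpace (normalizationι Y)
  haveI : IsLocallyNoetherian (normalization Y) :=
    LocallyOfFiniteType.isLocallyNoetherian (normalizationι Y ≫ g)
  refine ⟨normalization Y, normalizationι Y, inferInstance, isBirational_normalizationι Y g, ?_⟩
  exact logRegularAtlas_of_localLogRegularChart _ _
    (LocalCharts.stub_localCharts p k W f hW R π a E hE hNF)

/-- **The graded reduction of the crux** (line `SketchIdeator3`, skeleton v7): if Kato's
resolution of log-regular schemes `Kato1994_logRegular_hasResolution_general` (Kato 1994 (10.4);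
Nizioł 2006 Thm. 5.8) holds, and the Giraud–Cossart normal form exists in every dimension
`n ≥ 2` — for `R` a regular finitely generated `k`-domain of dimension `≤ n` (`char k = p`) and
`a ∈ R ∖ R^p` some proper birational `π : W → Spec R` with `W` regular integral and an snc
boundary `E` puts `π^* a` in Giraud normal form along `E` (Giraud 1983 Thm. 2.4 for `n = 2` over
perfect fields; Cossart 1987 for `n = 3` over algebraically closed fields; open for `n ≥ 4`) —
then `PicoverLocalModel` holds. Proof: the `n ≤ 1` case of the normal form is
`cossartNormalForm_le_one`; the atlas is `endgameAtlas`; conclude by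
`GiraudReduction.picoverLocalModel_of_normalForm_of_atlas`. [cite: Kato1994, (10.4)] -/
theorem picoverLocalModel_of_kato_of_normalForm_ge_two
    (hKato : Kato1994_logRegular_hasResolution_general.{0})
    (hNF₂ : ∀ (n : ℕ), 2 ≤ n → ∀ (p : ℕ), p.Prime → ∀ (k : Type) [Field k] [CharP k p]
      (R : Type) [CommRing R] [IsDomain R] [Algebra k R], Algebra.FiniteType k R →
      IsRegularRing R → ringKrullDim R ≤ n → ∀ a : R, (∀ b : R, b ^ p ≠ a) →
        ∃ (W : Scheme.{0}) (π : W ⟶ Spec (.of R)) (E : List W.IdealSheafData),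
          IsProper π ∧ IsBirational π ∧ IsIntegral W ∧ Scheme.IsRegular W ∧ HasSNC E ∧
            InGiraudNormalForm p W π a E) :
    Summit.ResolutionOfSingularities.ResolutionOfSingularities.Theses.PAlteration.PicoverLocalModel := by
  refine GiraudReduction.picoverLocalModel_of_normalForm_of_atlas hKato ?_ ?_
  · -- the residue, graded: `n ≤ 1` proved, `n ≥ 2` the hypothesis
    intro n p hp k _ _ R _ _ _ hft hreg hn a ha
    by_cases h : n ≤ 1
    · have hdim : ringKrullDim R ≤ 1 := hn.trans (by exact_mod_cast h)
      exact cossartNormalForm_le_one p hp k R hft hreg hdim a ha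
    · exact hNF₂ n (by omega) p hp k R hft hreg hn a ha
  · -- the atlas
    intro p _ k _ _ W f _ _ _ _ hW R _ π a E hE hNF hint
    exact endgameAtlas p k W f hW R π a E hE hNF hint

end Summit.ResolutionOfSingularities.ResolutionOfSingularities.Theorems.PicoverLocalModel.GiraudReductionGraded

end
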